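import Summits.RiemannHypothesis.RiemannHypothesis.Theorems.JensenLogBandArcRadius
import Mathlib.Analysis.Complex.ExponentialBounds
import HarnessLib

/-!
# The numeric regime of the BAND hypotheses (BAND line — plumbing for both stubs)

RH ladder column JENSEN, rung J-P(P3) «log band», BAND crux `XiDerivBandRealAllRates` of route
«JensenLogBand», line «band-one-window» (u-arc reshape), lead rh-jensen-prover g7. RH-FREE
elementary real analysis. WHAT THIS IS NOT: nothing here bears on zeros of `ζ` or the truth of RH.

Both registered stubs (`stub_nearZone`, `stub_farZone`) carry the band hypotheses
`0 < a ≤ ½`, `0 < T`, `64 (n/log n)² ≤ ‖(a+iT)²‖ < e^{cn}` (`0 < c < 8`) and conclude for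
`n ≥ n₁(c)`. The saddle analysis (`Theorems/JensenLogBandArcSaddle*.lean`) is stated in the regime
`T ≥ 100`, `ℓ_T ≥ ℓ₀` (`ℓ₀ ≥ 20`), `n ≥ 100`, `½ ≤ h(n,T) ≤ (7/20)T`. This file derives that regime
from the band hypotheses for every prescribed `ℓ₀` (`LogBandArc.band_regime`): the crux being
«`∃ n₁`», any threshold on `ℓ_T` is free — every loss `O(1/ℓ_T)` in the constants of steps S3–S5
can be absorbed by enlarging `ℓ₀` (LINE-PLAN §7).

Ingredients: `log n ≤ 2√n` (inlined; cf. `DFI1995.log_le_two_mul_sqrt`) (so `T² ≥ 16n − ¼`), `T ≥ 8n/log n − ½ ≥ 7.5·n/log n`,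
`log log n ≤ 1 + (log n)/e²`, `2 ≤ log 7.5`, `log(2π) ≤ 2`, whence `ℓ_T ≥ 0.8 log n` and
`(7/20)·T·ℓ_T ≥ 2.1 n ≥ 2(n+1)`; and `T² < e^{8n}` gives `ℓ_T < 4(n+1)`, i.e. `h ≥ ½`.
-/

noncomputable section

-- single-problem summit: `Summit.RiemannHypothesis.RiemannHypothesis.…` is the tree convention
set_option linter.dupNamespace false

open Complex Real

namespace Summit.RiemannHypothesis.RiemannHypothesis.Theorems.JensenPolynomials.LogBandArc

/-- `e² ∈ (7.38, 7.39)`. [folklore] -/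
theorem exp_two_bounds : (738 / 100 : ℝ) < Real.exp 2 ∧ Real.exp 2 < 739 / 100 := by
  have h : Real.exp 2 = Real.exp 1 ^ 2 := by
    rw [← Real.exp_nat_mul]; norm_num
  rw [h]
  constructor
  · nlinarith [Real.exp_one_gt_d9, Real.exp_pos 1]
  · nlinarith [Real.exp_one_lt_d9, Real.exp_one_gt_d9]

/-- `log(2π) ≤ 2` and `0 ≤ log(2π)`. [folklore] -/
theorem log_two_pi_bounds : 0 ≤ Real.log (2 * Real.pi) ∧ Real.log (2 * Real.pi) ≤ 2 := by
  constructor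
  · exact Real.log_nonneg (by linarith [Real.pi_gt_three])
  · rw [Real.log_le_iff_le_exp (by positivity)]
    linarith [exp_two_bounds.1, Real.pi_lt_d2]

/-- `log log y ≤ 1 + (log y)/e²` for `log y > 0`. [folklore] -/
theorem log_log_le {y : ℝ} (hy : 0 < Real.log y) :
    Real.log (Real.log y) ≤ 1 + Real.log y / Real.exp 2 := by
  have he : 0 < Real.exp 2 := Real.exp_pos 2
  have h1 : Real.log (Real.log y / Real.exp 2) ≤ Real.log y / Real.exp 2 - 1 :=
    Real.log_le_sub_one_of_pos (div_pos hy he)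
  rw [Real.log_div hy.ne' he.ne', Real.log_exp] at h1
  linarith

/-- **From the band to the height:** `0 < a ≤ ½`, `0 < T`, `64(n/log n)² ≤ a² + T²`, `n ≥ 4` ⇒
`T ≥ 8n/log n − ½` and `T² ≥ 16 n − ¼`. [folklore] -/
theorem height_of_band {n : ℕ} {a T : ℝ} (hn : 4 ≤ n) (ha : 0 < a) (ha2 : a ≤ 1 / 2) (hT : 0 < T)
    (hband : 64 * ((n : ℝ) / Real.log n) ^ 2 ≤ a ^ 2 + T ^ 2) :
    8 * (n : ℝ) / Real.log n - 1 / 2 ≤ T ∧ 16 * (n : ℝ) - 1 / 4 ≤ T ^ 2 ∧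
      1 ≤ (n : ℝ) / Real.log n := by
  have hn' : (4 : ℝ) ≤ n := by exact_mod_cast hn
  have hlog_pos : 0 < Real.log n := Real.log_pos (by linarith)
  -- `log n ≤ 2√n` (as in the tree's `DFI1995.log_le_two_mul_sqrt`; inlined to keep imports light)
  have hlog_le : Real.log n ≤ 2 * Real.sqrt n := by
    have h1 : Real.log (Real.sqrt n) ≤ Real.sqrt n - 1 :=
      Real.log_le_sub_one_of_pos (Real.sqrt_pos.2 (by linarith))
    rw [Real.log_sqrt (by linarith)] at h1
    linarith [Real.sqrt_nonneg (n : ℝ)]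
  have hsqrt : 2 ≤ Real.sqrt (n : ℝ) := by
    rw [show (2 : ℝ) = Real.sqrt 4 by rw [show (4:ℝ) = 2 ^ 2 by norm_num, Real.sqrt_sq (by norm_num)]]
    exact Real.sqrt_le_sqrt hn'
  have hsq : Real.sqrt (n : ℝ) ^ 2 = n := Real.sq_sqrt (by linarith)
  -- `n / log n ≥ √n/2 ≥ 1` and `(n/log n)² ≥ n/4`
  have hq : Real.sqrt n / 2 ≤ (n : ℝ) / Real.log n := by
    rw [div_le_div_iff₀ (by norm_num) hlog_pos]
    nlinarith [hlog_le, Real.sqrt_nonneg (n : ℝ)]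
  have hq1 : 1 ≤ (n : ℝ) / Real.log n := by linarith
  have hq2 : (n : ℝ) / 4 ≤ ((n : ℝ) / Real.log n) ^ 2 := by
    have := pow_le_pow_left₀ (by positivity) hq 2
    rw [div_pow, hsq] at this
    linarith
  have ha' : a ^ 2 ≤ 1 / 4 := by nlinarith
  refine ⟨?_, by linarith, hq1⟩
  -- `(8q − ½)² ≤ 64 q² − ¼ ≤ T²` with `q = n/log n ≥ 1`
  have hsq' : (8 * (n : ℝ) / Real.log n - 1 / 2) ^ 2 ≤ T ^ 2 := by
    have e : (8 * (n : ℝ) / Real.log n - 1 / 2) ^ 2 =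
        64 * ((n : ℝ) / Real.log n) ^ 2 - 8 * ((n : ℝ) / Real.log n) + 1 / 4 := by ring
    rw [e]; linarith
  have hpos : 0 ≤ 8 * (n : ℝ) / Real.log n - 1 / 2 := by
    have : 8 * (n : ℝ) / Real.log n = 8 * ((n : ℝ) / Real.log n) := by ring
    rw [this]; linarith
  exact (pow_le_pow_iff_left₀ hpos hT.le two_ne_zero).1 hsq'

/-- **The regime of the BAND hypotheses.** For every `ℓ₀` and every `0 < c ≤ 8` there is `n₁` such
that for `n ≥ n₁`, `0 < a ≤ ½`, `0 < T`, `64(n/log n)² ≤ ‖(a+iT)²‖ < e^{cn}`: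
`T ≥ 100`, `ℓ_T ≥ ℓ₀`, `½ ≤ h(n,T) ≤ (7/20)·T`. [folklore] -/
theorem band_regime (ℓ₀ c : ℝ) (hc8 : c ≤ 8) :
    ∃ n₁ : ℕ, ∀ n : ℕ, n₁ ≤ n → ∀ a T : ℝ, 0 < a → a ≤ 1 / 2 → 0 < T →
      64 * ((n : ℝ) / Real.log n) ^ 2 ≤ ‖((a : ℂ) + (T : ℂ) * I) ^ 2‖ →
      ‖((a : ℂ) + (T : ℂ) * I) ^ 2‖ < Real.exp (c * (n : ℝ)) →
      100 ≤ T ∧ ℓ₀ ≤ ell T ∧ 1 / 2 ≤ bandRadius n T ∧ bandRadius n T ≤ 7 / 20 * T := by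
  -- thresholds: n ≥ 9·10⁶ (so log n ≥ 16) and 16 n ≥ (2π e^{L})² + 1, L = max ℓ₀ 2
  set L : ℝ := max ℓ₀ 2 with hL
  set B : ℝ := 2 * Real.pi * Real.exp L with hB
  have hB0 : 0 < B := by positivity
  obtain ⟨N, hN⟩ := exists_nat_ge ((B ^ 2 + 1) / 16)
  refine ⟨max 9000000 N, fun n hn a T ha ha2 hT hlo hhi => ?_⟩
  have hn9 : 9000000 ≤ n := le_trans (le_max_left _ _) hn
  have hnN : N ≤ n := le_trans (le_max_right _ _) hn
  have hn' : (9000000 : ℝ) ≤ n := by exact_mod_cast hn9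
  have hnN' : (N : ℝ) ≤ n := by exact_mod_cast hnN
  rw [norm_sq_ofReal_add_mul_I] at hlo hhi
  obtain ⟨hT8, hT16, hq1⟩ := height_of_band (by omega) ha ha2 hT hlo
  have hlog_pos : 0 < Real.log n := Real.log_pos (by linarith)
  -- (1) T ≥ 100
  have hT100 : 100 ≤ T := by nlinarith
  -- (2) ℓ_T ≥ L ≥ ℓ₀ (and ≥ 2)
  have hTB : B ≤ T := by
    have : B ^ 2 ≤ T ^ 2 := by nlinarith
    exact (pow_le_pow_iff_left₀ hB0.le hT.le two_ne_zero).1 this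
  have hellL : L ≤ ell T := by
    rw [ell, Real.le_log_iff_exp_le (by positivity), le_div_iff₀ (by positivity)]
    calc Real.exp L * (2 * Real.pi) = B := by rw [hB]; ring
      _ ≤ T := hTB
  have hell2 : 2 ≤ ell T := le_trans (le_max_right _ _) hellL
  have hell0 : 0 < ell T := by linarith
  refine ⟨hT100, le_trans (le_max_left _ _) hellL, ?_, ?_⟩
  · -- (3) h ≥ ½ : ℓ_T ≤ log T < 4n ≤ 4(n+1)
    have hT2 : T ^ 2 < Real.exp (8 * (n : ℝ)) := by
      have h1 : a ^ 2 + T ^ 2 < Real.exp (8 * (n : ℝ)) :=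
        hhi.trans_le (Real.exp_le_exp.2 (by nlinarith))
      nlinarith
    have hlogT : Real.log T < 4 * (n : ℝ) := by
      have h1 : Real.log (T ^ 2) < 8 * (n : ℝ) := by
        rw [Real.log_lt_iff_lt_exp (by positivity)]; exact hT2
      rw [Real.log_pow] at h1
      push_cast at h1
      linarith
    have hell_le : ell T ≤ Real.log T := by
      rw [ell, Real.log_div hT.ne' (by positivity)]
      linarith [log_two_pi_bounds.1]
    rw [bandRadius, le_div_iff₀ hell0]
    linarith
  · -- (4) h ≤ (7/20) T : 2(n+1) ≤ (7/20) T ℓ_T from T ≥ 7.5 n/log n and ℓ_T ≥ 0.8 log n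
    have hlog16 : 16 ≤ Real.log n := by
      rw [Real.le_log_iff_exp_le (by linarith)]
      have h1 : Real.exp 16 = Real.exp 1 ^ 16 := by
        rw [← Real.exp_nat_mul]; norm_num
      rw [h1]
      have h2 : Real.exp 1 ^ 16 ≤ (272 / 100 : ℝ) ^ 16 :=
        pow_le_pow_left₀ (Real.exp_pos 1).le (Real.exp_one_lt_d9.le.trans (by norm_num)) 16
      exact h2.trans (le_trans (by norm_num) hn')
    -- T ≥ 7.5 n / log n
    have hT75 : 15 / 2 * ((n : ℝ) / Real.log n) ≤ T := by
      have : 8 * (n : ℝ) / Real.log n = 8 * ((n : ℝ) / Real.log n) := by ring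
      rw [this] at hT8
      linarith
    have hq_pos : 0 < (n : ℝ) / Real.log n := by positivity
    -- log T ≥ log 7.5 + log n − log log n ≥ 2 + log n − (1 + log n / e²)
    have hlogT : 2 + Real.log n - (1 + Real.log n / Real.exp 2) ≤ Real.log T := by
      have h1 : Real.log (15 / 2 * ((n : ℝ) / Real.log n)) ≤ Real.log T :=
        Real.log_le_log (by positivity) hT75
      rw [Real.log_mul (by norm_num) hq_pos.ne', Real.log_div (by positivity) hlog_pos.ne'] at h1
      have h75 : 2 ≤ Real.log (15 / 2 : ℝ) := by
        rw [Real.le_log_iff_exp_le (by norm_num)]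
        linarith [exp_two_bounds.2]
      have hll := log_log_le hlog_pos
      linarith
    have he2 : Real.log n / Real.exp 2 ≤ Real.log n * (100 / 738) := by
      rw [div_eq_mul_inv]
      apply mul_le_mul_of_nonneg_left _ hlog_pos.le
      rw [inv_le_comm₀ (Real.exp_pos 2) (by norm_num)]
      linarith [exp_two_bounds.1]
    -- ℓ_T ≥ 0.8 log n
    have hell : 4 / 5 * Real.log n ≤ ell T := by
      rw [ell, Real.log_div hT.ne' (by positivity)]
      linarith [log_two_pi_bounds.2]
    -- conclude
    rw [bandRadius, div_le_iff₀ hell0]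
    have h1 : 7 / 20 * T * ell T ≥ 7 / 20 * (15 / 2 * ((n : ℝ) / Real.log n)) * (4 / 5 * Real.log n) :=
      mul_le_mul (mul_le_mul_of_nonneg_left hT75 (by norm_num)) hell (by positivity) (by positivity)
    have h2 : 7 / 20 * (15 / 2 * ((n : ℝ) / Real.log n)) * (4 / 5 * Real.log n) = 21 / 10 * n := by
      field_simp
      ring
    linarith

end Summit.RiemannHypothesis.RiemannHypothesis.Theorems.JensenPolynomials.LogBandArc

end
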